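import Mathlib
import Literature.RingTheory.CohomologyAnnihilator.Basic
import Literature.RingTheory.CohomologyAnnihilator.StableAnnihilation
import Summits.ResolutionOfSingularities.ResolutionOfSingularities.Theorems.HomologicalConductorPersistenceExtFlatBaseChange
import Summits.ResolutionOfSingularities.ResolutionOfSingularities.Theorems.HomologicalConductorPersistenceRelativeSequence
import HarnessLib

/-!
# LEVEL DROP along a polynomial extension: `caⁿ⁺¹(A[x])` evaluates into `caⁿ(A)`

Route `ResolutionOfSingularities/HomologicalConductor`, chain W4.4b: rung S-2 `PersistenceSurface`
(stmt-ResolutionOfSingularities-19970, stub C1 `SaturationFourSurfaceResidual₄` at NON-NORMAL product-type stages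
`T₀ = (B × line)`) and the all-dimension crux `Persistence` (stmt-ResolutionOfSingularities-16484, the `V × line` kill
tests).  [OURS · folklore homological algebra (Cartan–Eilenberg change of rings / the Koszul splitting
`Extⁱ_{A[x]}(M, N) = Extⁱ_A(M, N) ⊕ Extⁱ⁻¹_A(M, N)` for `A`-modules `M, N` on which `x` acts as `0`) over LANDED tree
lemmas; AI-written, weaker than expert review; NOT a statement of the manuscript under study (Hironaka 2017) and no
statement of that manuscript is used.]  DEF-FREE: no new `def`, no conjecture, no named fact.

Setting: `A` a commutative ring, `R` a commutative `A`-algebra free on the powers of an element `x` (`b : Module.Basis ℕ A R`,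
`b n = xⁿ`; e.g. `R = A[X]`), `M` an `R`-module on which `x` ACTS AS ZERO.  Then the relative sequence of
`…PersistenceRelativeSequence` (THEOREM-A (1.1), `0 → R ⊗_A M —T→ R ⊗_A M —μ→ M → 0`) has `T = x • 𝟙` (`ofHom_T_eq_smul_id`),
so for an `R`-module `N` on which `x` also acts as zero the connecting map `Extⁱ_R(R ⊗_A M, N) → Extⁱ⁺¹_R(M, N)` is
INJECTIVE (`x` acts as `0` on `Ext_R(−, N)`), and `Extⁱ_R(R ⊗_A M, N) ≅ Extⁱ_A(M|_A, N|_A)` by the flat base change of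
`…PersistenceExtFlatBaseChange`.  Consequences (the direction OPPOSITE to THEOREM-A's exponent-two corollaries, which go UP
one level at the price of a square):

* `smul_ext_eq_zero_of_smul_ext_baseChange_eq_zero` — CONVERSE flat transfer: for a flat `A`-algebra `R`, if `algebraMap c`
  kills `Extⁿ_R(R ⊗_A X, N)` then `c` kills `Extⁿ_A(X, N|_A)` (injectivity of the base-change bijection);
* `smul_ext_baseChange_eq_zero_of_smul_ext_succ_eq_zero` — `c • Extⁱ⁺¹_R(M, N) = 0 ⇒ c • Extⁱ_R(R ⊗_A M, N) = 0` when `x` kills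
  `M` and `N`;
* **`smul_ext_eq_zero_of_smul_ext_succ_eq_zero`** — LEVEL DROP in `A`-currency: `(algebraMap c) • Extⁱ⁺¹_R(M, N) = 0 ⇒
  c • Extⁱ_A(M, N) = 0` (`x` kills `M`, `N`);
* **`augmentation_mem_cohomologyAnnihilatorOfDegree`** — for an `A`-algebra augmentation `ε : R →ₐ[A] A` with `ε x = 0`:
  `c ∈ caⁿ⁺¹(R) ⇒ ε c ∈ caⁿ(A)` (every finitely generated `A`-module is an `R`-module through `ε`, with `x` acting as zero);
  `augmentation_mem_cohomologyAnnihilator` (unlevelled);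
* `eval_zero_mem_cohomologyAnnihilatorOfDegree`, `mem_cohomologyAnnihilatorOfDegree_of_C_mem`,
  `eval_zero_mem_cohomologyAnnihilator` — the polynomial ring `A[X]` literally: `p ∈ caⁿ⁺¹(A[X]) ⇒ p(0) ∈ caⁿ(A)`, in
  particular `caⁿ⁺¹(A[X]) ∩ A ⊆ caⁿ(A)`.

USE.  Together with THEOREM-A Cor. (3.2) (`c ∈ caⁿ(A)`-type data ⇒ `c²`-type data in `caⁿ⁺¹(A[X])`) the levels of `ca(A[X])` sit
exactly one above those of `ca(A)` up to squares; contrapositively `c ∉ caⁿ(A) ⇒ c ∉ caⁿ⁺¹(A[X])` LIFTS every level-wise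
non-membership from `A` to `A × line` with exponent one — the tool for reading `Sat₄` at a product-type stage `B × line`
(`Sat₄ ⇒ ca⁴(B[X]) ∩ B ⊆ ca³(B)`) and for the `V × line` tables of the all-dimension crux.  Nothing here is specific to surfaces.

References (mechanism only): H. Cartan, S. Eilenberg, *Homological Algebra* (1956), Ch. VI (change of rings); S. B. Iyengar,
R. Takahashi, IMRN 2016, §2 [`IyengarTakahashi2014`].
-/

-- single-problem summit: the doubled namespace component `ResolutionOfSingularities` is forced
set_option linter.dupNamespace false

noncomputable section

namespace Summit.ResolutionOfSingularities.ResolutionOfSingularities.Theorems.HomologicalConductor.PersistenceHyperplaneLevelDrop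

open CategoryTheory CategoryTheory.Abelian Polynomial Literature.RingTheory.CohomologyAnnihilator
open Summit.ResolutionOfSingularities.ResolutionOfSingularities.Theorems.HomologicalConductor.PersistenceExtFlatBaseChange
open Summit.ResolutionOfSingularities.ResolutionOfSingularities.Theorems.HomologicalConductor.PersistenceRelativeSequence
open scoped TensorProduct

universe u

/-! ## Scalars that kill a module act as zero on `Ext` -/

section Kill

variable {R : Type u} [CommRing R]

/-- If `x` kills the `R`-module `N` then `x • e = 0` for every `e : Extⁱ_R(Y, N)` (the action is postcomposition with
the homothety `x • 𝟙 N = 0`, Mathlib's `Ext.smul_eq_comp_mk₀`). [folklore] -/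
theorem smul_ext_eq_zero_of_smul_eq_zero₂ {Y N : ModuleCat.{u} R} {x : R} (hxN : ∀ n : N, x • n = 0) {i : ℕ}
    (e : Ext.{u} Y N i) : x • e = 0 := by
  have h0 : x • 𝟙 N = 0 := by
    apply ModuleCat.hom_ext
    refine LinearMap.ext fun n => ?_
    simp [hxN n]
  rw [Ext.smul_eq_comp_mk₀, h0, Ext.mk₀_zero, Ext.comp_zero]

/-- If `x` kills the `R`-module `Y` then `x • e = 0` for every `e : Extⁱ_R(Y, N)` (precomposition with `x • 𝟙 Y = 0`).
[folklore] -/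
theorem smul_ext_eq_zero_of_smul_eq_zero₁ {Y N : ModuleCat.{u} R} {x : R} (hxY : ∀ y : Y, x • y = 0) {i : ℕ}
    (e : Ext.{u} Y N i) : x • e = 0 := by
  have h0 : x • 𝟙 Y = 0 := by
    apply ModuleCat.hom_ext
    refine LinearMap.ext fun y => ?_
    simp [hxY y]
  rw [smul_eq_mk₀_smul_id_comp, h0, Ext.mk₀_zero, Ext.zero_comp]

end Kill

/-! ## The converse flat transfer -/

section Converse

variable {A R : Type u} [CommRing A] [CommRing R] [Algebra A R] [Module.Flat A R]

/-- **Converse annihilator transfer along a flat algebra.**  For `R` a flat `A`-algebra, an `A`-module `X` and an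
`R`-module `N`: if `algebraMap A R c` kills `Extⁿ_R(R ⊗[A] X, N)` then `c` kills `Extⁿ_A(X, N|_A)` — the base-change map
`Extⁿ_A(X, N|_A) → Extⁿ_R(R ⊗_A X, N)` of `…PersistenceExtFlatBaseChange.exists_extBaseChange` is a bijection compatible with
the scalar actions, in particular INJECTIVE. [folklore] -/
theorem smul_ext_eq_zero_of_smul_ext_baseChange_eq_zero {X : Type u} [AddCommGroup X] [Module A X]
    {N : ModuleCat.{u} R} {n : ℕ} {c : A}
    (hc : ∀ e : Ext.{u} (ModuleCat.of R (R ⊗[A] X)) N n, algebraMap A R c • e = 0)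
    (e : Ext.{u} (ModuleCat.of A X) ((ModuleCat.restrictScalars.{u, u, u} (algebraMap A R)).obj N) n) :
    c • e = 0 := by
  have hf : (algebraMap A R).Flat := RingHom.flat_algebraMap_iff.mpr inferInstance
  obtain ⟨Φ, hbij, hsmul, -, -⟩ := exists_extBaseChange (algebraMap A R) hf N n
  obtain ⟨ι⟩ := nonempty_iso_extendScalars (A := A) (R := R) X
  have hc' : ∀ e' : Ext.{u} ((ModuleCat.extendScalars.{u, u, u} (algebraMap A R)).obj (ModuleCat.of A X)) N n,
      algebraMap A R c • e' = 0 := fun e' => smul_ext_eq_zero_of_iso₁ ι.symm hc e'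
  apply (hbij (ModuleCat.of A X)).1
  rw [hsmul, hc', map_zero]

/-- The same with the coefficients given as a module `N` carrying compatible `A`- and `R`-structures:
`algebraMap c` kills `Extⁿ_R(R ⊗[A] X, N)` ⇒ `c` kills `Extⁿ_A(X, N)`. [folklore] -/
theorem smul_ext_eq_zero_of_smul_ext_baseChange_eq_zero' {X : Type u} [AddCommGroup X] [Module A X]
    {N : Type u} [AddCommGroup N] [Module A N] [Module R N] [IsScalarTower A R N] {n : ℕ} {c : A}
    (hc : ∀ e : Ext.{u} (ModuleCat.of R (R ⊗[A] X)) (ModuleCat.of R N) n, algebraMap A R c • e = 0)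
    (e : Ext.{u} (ModuleCat.of A X) (ModuleCat.of A N) n) : c • e = 0 := by
  obtain ⟨κ⟩ := nonempty_iso_restrictScalars (A := A) (R := R) N
  exact smul_ext_eq_zero_of_iso₂ κ (smul_ext_eq_zero_of_smul_ext_baseChange_eq_zero hc) e

end Converse

/-! ## The level drop -/

section Drop

variable {A R : Type u} [CommRing A] [CommRing R] [Algebra A R] (x : R) (b : Module.Basis ℕ A R)
  (hb : ∀ n : ℕ, b n = x ^ n) {M : Type u} [AddCommGroup M] [Module A M] [Module R M]
  [IsScalarTower A R M]

omit [IsScalarTower A R M] in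
/-- When `x` acts as zero on `M`, the map `T = x ⊗ 1 − 1 ⊗ x_M` of the relative sequence is the homothety `x • 𝟙` of
`R ⊗_A M`. [folklore] -/
theorem ofHom_T_eq_smul_id (hxM : ∀ m : M, x • m = 0) (T : R ⊗[A] M →ₗ[R] R ⊗[A] M)
    (hT : ∀ (p : R) (m : M), T (p ⊗ₜ[A] m) = (x * p) ⊗ₜ[A] m - p ⊗ₜ[A] (x • m)) :
    ModuleCat.ofHom (X := R ⊗[A] M) (Y := R ⊗[A] M) T = x • 𝟙 (ModuleCat.of R (R ⊗[A] M)) := by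
  apply ModuleCat.hom_ext
  refine LinearMap.ext fun z => ?_
  induction z using TensorProduct.induction_on with
  | zero => simp
  | tmul p m =>
    change T (p ⊗ₜ[A] m) = x • (p ⊗ₜ[A] m)
    rw [hT, hxM, TensorProduct.tmul_zero, sub_zero, TensorProduct.smul_tmul', smul_eq_mul]
  | add z w hz hw =>
    change T (z + w) = x • (z + w)
    change T z = x • z at hz
    change T w = x • w at hw
    rw [map_add, hz, hw, smul_add]

include hb in
/-- **Level drop, `R`-currency.**  `x` acts as zero on the `R`-modules `M` and `N`; if `c : R` kills `Extⁱ⁺¹_R(M, N)` then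
`c` kills `Extⁱ_R(R ⊗_A M, N)`.  Proof: in the long exact sequence of the relative sequence
`0 → R ⊗_A M —x→ R ⊗_A M → M → 0`, `δ (c • e) = c • δ e = 0`, so `c • e = x • y` for some `y`, and `x` acts as zero on
`Ext_R(−, N)`. [folklore] -/
theorem smul_ext_baseChange_eq_zero_of_smul_ext_succ_eq_zero (hxM : ∀ m : M, x • m = 0) {N : ModuleCat.{u} R}
    (hxN : ∀ n : N, x • n = 0) {i : ℕ} {c : R}
    (hc : ∀ e : Ext.{u} (ModuleCat.of R M) N (i + 1), c • e = 0)
    (e : Ext.{u} (ModuleCat.of R (R ⊗[A] M)) N i) : c • e = 0 := by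
  obtain ⟨T, μ, hT, hμ⟩ := exists_relativeMaps (A := A) x (M := M)
  obtain ⟨w, hS⟩ := relativeSequence_shortExact x b hb T μ hT hμ
  have hδ : hS.extClass.comp (c • e) (add_comm 1 i) = 0 := by
    rw [Ext.comp_smul]
    exact hc _
  obtain ⟨y, hy⟩ := Ext.contravariant_sequence_exact₁ hS N (c • e) (add_comm 1 i) hδ
  rw [← hy]
  change (Ext.mk₀ (ModuleCat.ofHom (X := R ⊗[A] M) (Y := R ⊗[A] M) T)).comp y (zero_add i) = 0
  rw [ofHom_T_eq_smul_id x hxM T hT, ← smul_eq_mk₀_smul_id_comp]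
  exact smul_ext_eq_zero_of_smul_eq_zero₂ hxN y

include hb in
/-- **LEVEL DROP, `A`-currency.**  `R` free over `A` on the powers of `x`; `M`, `N` modules with compatible `A`- and
`R`-structures on which `x` acts as zero.  If `algebraMap A R c` kills `Extⁱ⁺¹_R(M, N)` then `c` kills `Extⁱ_A(M, N)`:
`Extⁱ_A(M, N) ≅ Extⁱ_R(R ⊗_A M, N) ↪ Extⁱ⁺¹_R(M, N)`. [folklore] -/
theorem smul_ext_eq_zero_of_smul_ext_succ_eq_zero (hxM : ∀ m : M, x • m = 0) {N : Type u} [AddCommGroup N]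
    [Module A N] [Module R N] [IsScalarTower A R N] (hxN : ∀ n : N, x • n = 0) {i : ℕ} {c : A}
    (hc : ∀ e : Ext.{u} (ModuleCat.of R M) (ModuleCat.of R N) (i + 1), algebraMap A R c • e = 0)
    (e : Ext.{u} (ModuleCat.of A M) (ModuleCat.of A N) i) : c • e = 0 := by
  haveI : Module.Free A R := Module.Free.of_basis b
  exact smul_ext_eq_zero_of_smul_ext_baseChange_eq_zero'
    (smul_ext_baseChange_eq_zero_of_smul_ext_succ_eq_zero x b hb hxM (N := ModuleCat.of R N) hxN hc) e

end Drop

/-! ## `caⁿ⁺¹(R)` evaluates into `caⁿ(A)` along an augmentation killing `x` -/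

section Augmentation

variable {A R : Type u} [CommRing A] [CommRing R] [Algebra A R] (x : R) (b : Module.Basis ℕ A R)
  (hb : ∀ n : ℕ, b n = x ^ n) (ε : R →ₐ[A] A) (hε : ε x = 0)

include hb hε in
/-- **`c ∈ caⁿ⁺¹(R) ⇒ ε c ∈ caⁿ(A)`** for an `A`-algebra `R` free on the powers of `x` and an augmentation `ε : R →ₐ[A] A`
with `ε x = 0` (e.g. `R = A[X]`, `ε = ` evaluation at `0`).  Every finitely generated `A`-module is a finitely generated
`R`-module through `ε`, with `x` acting as zero and `c` acting as `ε c`; apply the level drop. [folklore] -/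
theorem augmentation_mem_cohomologyAnnihilatorOfDegree {n : ℕ} {c : R}
    (hc : c ∈ cohomologyAnnihilatorOfDegree R (n + 1)) : ε c ∈ cohomologyAnnihilatorOfDegree A n := by
  rw [mem_cohomologyAnnihilatorOfDegree_iff]
  intro i hi M N hM hN e
  -- the `R`-structures through `ε` (on the same carriers)
  letI instM : Module R M := Module.compHom M ε.toRingHom
  letI instN : Module R N := Module.compHom N ε.toRingHom
  have hsmulM : ∀ (p : R) (m : M), p • m = ε p • m := fun _ _ => rfl
  have hsmulN : ∀ (p : R) (m : N), p • m = ε p • m := fun _ _ => rfl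
  haveI : IsScalarTower A R M := ⟨fun a p m => by
    rw [hsmulM, hsmulM, map_smul, smul_assoc]⟩
  haveI : IsScalarTower A R N := ⟨fun a p m => by
    rw [hsmulN, hsmulN, map_smul, smul_assoc]⟩
  haveI : Module.Finite A M := hM
  haveI : Module.Finite A N := hN
  haveI : Module.Finite R M := Module.Finite.of_restrictScalars_finite A R M
  haveI : Module.Finite R N := Module.Finite.of_restrictScalars_finite A R N
  have hxM : ∀ m : M, x • m = 0 := fun m => by rw [hsmulM, hε, zero_smul]
  have hxN : ∀ m : N, x • m = 0 := fun m => by rw [hsmulN, hε, zero_smul]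
  -- `c` acts on `Ext_R(M, N)` as `algebraMap (ε c)`: the difference kills `M`
  have hεc : ε (algebraMap A R (ε c)) = ε c := by simp
  have hker : ∀ m : M, (c - algebraMap A R (ε c)) • m = 0 := fun m => by
    rw [hsmulM, map_sub, hεc, sub_self, zero_smul]
  have hc' : ∀ e' : Ext.{u} (ModuleCat.of R M) (ModuleCat.of R N) (i + 1), algebraMap A R (ε c) • e' = 0 := by
    intro e'
    have h1 : c • e' = 0 :=
      (mem_cohomologyAnnihilatorOfDegree_iff.mp hc) (i + 1) (by omega) (ModuleCat.of R M) (ModuleCat.of R N)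
        inferInstance inferInstance e'
    have h2 : (c - algebraMap A R (ε c)) • e' = 0 :=
      smul_ext_eq_zero_of_smul_eq_zero₁ (Y := ModuleCat.of R M) hker e'
    rw [sub_smul, h1, zero_sub, neg_eq_zero] at h2
    exact h2
  exact smul_ext_eq_zero_of_smul_ext_succ_eq_zero x b hb (M := M) hxM (N := N) hxN hc' e

include hb hε in
/-- Unlevelled: `c ∈ ca(R) ⇒ ε c ∈ ca(A)`. [folklore] -/
theorem augmentation_mem_cohomologyAnnihilator {c : R} (hc : c ∈ cohomologyAnnihilator R) :
    ε c ∈ cohomologyAnnihilator A := by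
  obtain ⟨n, hn⟩ := mem_cohomologyAnnihilator_iff.mp hc
  exact mem_cohomologyAnnihilator_iff.mpr
    ⟨n, augmentation_mem_cohomologyAnnihilatorOfDegree x b hb ε hε (cohomologyAnnihilatorOfDegree_mono (Nat.le_succ n) hn)⟩

end Augmentation

/-! ## The polynomial ring `A[X]` literally -/

section PolynomialRing

variable {A : Type u} [CommRing A]

/-- **`p ∈ caⁿ⁺¹(A[X]) ⇒ p(0) ∈ caⁿ(A)`.** [folklore] -/
theorem eval_zero_mem_cohomologyAnnihilatorOfDegree {n : ℕ} {p : A[X]}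
    (hp : p ∈ cohomologyAnnihilatorOfDegree A[X] (n + 1)) : p.eval 0 ∈ cohomologyAnnihilatorOfDegree A n := by
  have h := augmentation_mem_cohomologyAnnihilatorOfDegree (X : A[X]) (Polynomial.basisMonomials A)
    basisMonomials_eq_pow (Polynomial.aeval (0 : A)) (by simp) hp
  simpa [Polynomial.aeval_def, Polynomial.eval₂_eq_eval_map] using h

/-- **`caⁿ⁺¹(A[X]) ∩ A ⊆ caⁿ(A)`**: if the constant `C c` lies in `caⁿ⁺¹(A[X])` then `c ∈ caⁿ(A)`. [folklore] -/
theorem mem_cohomologyAnnihilatorOfDegree_of_C_mem {n : ℕ} {c : A}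
    (hc : Polynomial.C c ∈ cohomologyAnnihilatorOfDegree A[X] (n + 1)) : c ∈ cohomologyAnnihilatorOfDegree A n := by
  simpa using eval_zero_mem_cohomologyAnnihilatorOfDegree hc

/-- Unlevelled: `p ∈ ca(A[X]) ⇒ p(0) ∈ ca(A)`. [folklore] -/
theorem eval_zero_mem_cohomologyAnnihilator {p : A[X]} (hp : p ∈ cohomologyAnnihilator A[X]) :
    p.eval 0 ∈ cohomologyAnnihilator A := by
  obtain ⟨n, hn⟩ := mem_cohomologyAnnihilator_iff.mp hp
  exact mem_cohomologyAnnihilator_iff.mpr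
    ⟨n, eval_zero_mem_cohomologyAnnihilatorOfDegree (cohomologyAnnihilatorOfDegree_mono (Nat.le_succ n) hn)⟩

/-- Contrapositive, the LIFTING form used in kill tests: `c ∉ caⁿ(A) ⇒ C c ∉ caⁿ⁺¹(A[X])`. [folklore] -/
theorem C_not_mem_cohomologyAnnihilatorOfDegree_succ {n : ℕ} {c : A} (hc : c ∉ cohomologyAnnihilatorOfDegree A n) :
    Polynomial.C c ∉ cohomologyAnnihilatorOfDegree A[X] (n + 1) :=
  fun h => hc (mem_cohomologyAnnihilatorOfDegree_of_C_mem h)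

end PolynomialRing

end Summit.ResolutionOfSingularities.ResolutionOfSingularities.Theorems.HomologicalConductor.PersistenceHyperplaneLevelDrop

end
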